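/-
Copyright (c) 2026 the pub-hodgecm-mathlib formalisation cell (harness21).  Prover seat hodgecm-mathlib-R90-C133-p03 (g2) (lent by the S5 dealer to S4; deal-by-default
R90-C133-plan (g2) 2026-09-04T23:31:20Z, S4 dealer seat vacant), Track B ∕ K2-LIT, h413 = `stmt-HodgeConjecture-24833`, R90-TF section S4: the PRINT FACTS behind socket (LK-1D)
`stub_R90_S4_lk_oneDimPkt` («one-dimensional representations of `H_v` are L-packets of cardinality one», Rogawski §12.1 p. 171 type (3)) over ★ carriers only.
-/
import Summits.HodgeConjecture.HodgeConjecture.Theorems.R90S3HPacketTypeHomogeneity     -- ★ (S3 p05) `R90.S3.eq_of_u2SimilConj_mk_ofChar`, `R90.S3.eq_singleton_of_mem_of_isOneDimH` (T1); brings ★ `R90S4SimilConjEquivalence` (`R90.S4.u2SimilConj_refl`), ★ `IrreducibleClassesBoxCharRigidity` ((L4) `IrrClass.mk_ofChar_eq_boxChar`), ★ `HeckeEigencharacterPackage` (`IrrClass.isAdmissible_mk`), ★ `SmoothCharacterOfCharacter` (`SmoothIrrep.ofChar`, `isAdmissible_trivial_twist`), ★ `LocalUnitaryGroupCongr` (`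cmDatumLocalCongr`)
import HarnessLib

/-!
# R90-TF · S4 — `R90S4OneDimCharClass`: (LK-1D) «ONE-DIMENSIONAL REPRESENTATIONS OF `H_v = U(Φ₂)_v × U(Φ₁)_v` ARE L-PACKETS OF CARDINALITY ONE», Theorems side

Cell `hodgecm-mathlib`, crux H413 = `stmt-HodgeConjecture-24833`, route of record `HCCMUnconditional`; R90-TF section S4 (base `R90-C131`); hand R90-C133-p03 (g2), lent by the S5
dealer R90-C133-plan (g2) (deal-by-default 2026-09-04T23:31:20Z under LEAD #33∕#36 mechanics; S4 dealer seat vacant).  THEOREMS ONLY (no `def`, no `instance`, no `notation`,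
no named-fact hypothesis, no `sorry`; default heartbeats); lane `--supports stmt-HodgeConjecture-24833 --as helper` (count-neutral).  L9: NO `Lines` import — S4-B's `IsOneDimH` ∕
`IsU2SimilConj` ∕ `IsRogPacketU2` ∕ `IsRogPacketH` ∕ `Φ₂Loc` ∕ `U2Loc` ∕ `U1Loc` ∕ `HLoc` (`Cruxes/H413/Lines/R90_S4_HPacketsU2B.lean` :190–:215, :338) are met by their UNFOLDED bodies, byte
for byte as ★ `R90S3HPacketTypeHomogeneity` ∕ ★ `R90S4SimilConjEquivalence` already spell them; S4-A's socket `stub_R90_S4_lk_oneDimPkt (r : SmoothIrrep (HLoc L v))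
(h1 : Module.finrank ℂ r.V = 1) : IsRogPacketH L v {IrrClass.mk r} ∧ ∀ S, IsRogPacketH L v S → IrrClass.mk r ∈ S → S = {IrrClass.mk r}` (R90-C131-typ1 (g2), A ED. 4) is then
`:= R90.S4.packetH_singleton_and_eq_singleton_of_finrank_eq_one L v r h1`, a definitional fold.

REUSE, NOT RESTATEMENT.  Two of the three facts the print rests on are ALREADY ★: «a character class of `U(Φ₂)(L⁺_v)` is fixed by every similitude conjugation `Ad(T)`»
(★ `R90.S3.char_apply_cmDatumLocalCongr` ∕ `comap_cmDatumLocalCongr_mk_ofChar` ∕ `eq_of_u2SimilConj_mk_ofChar`, from ★ `F0P3bXiStablyInvariant.apply_eq_one_of_det_eq_one_antidiagOne`: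
`det (T g T⁻¹ g⁻¹) = 1` and every homomorphism to an abelian group kills `SU` — Dieudonné at non-split `v`, `GL₂`-abelianisation at split `v`) and «an `H_v`-packet with a
one-dimensional member `⟦ℂ_Ξ⟧` is `{⟦ℂ_Ξ⟧}`» (★ `R90.S3.eq_singleton_of_mem_of_isOneDimH`, T1); similitude conjugacy is reflexive (★ `R90.S4.u2SimilConj_refl`).  NEW HERE:
* §1 **`exists_mk_eq_mk_ofChar_of_finrank_eq_one`** (any topological group `G`): a smooth irreducible `r` with `finrank ℂ r.V = 1` IS `⟦ℂ_Ξ⟧` for a character `Ξ` with open kernel —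
  `Ξ(g)` = the scalar by which `r(g)` acts on the line, `ker Ξ` = the stabiliser of a generator (open by smoothness), the equivalence `z ↦ z • v`; i.e. `finrank = 1 ⇒ IsOneDimH` (S4-B
  :338, unfolded) — brick (b1) of R90-C131-typ1 (g2)'s kernel-checked assembly (R90 bus 23:35:33Z); with ★ (L4) `IrrClass.mk_ofChar_eq_boxChar`: `⟦r⟧ = boxChar χ ⟦ℂ_ψ⟧` on `G × G₁`.
* §2 **`isAdmissible_and_mem_singleton_iff_u2SimilConj`**: `{⟦ℂ_ψ⟧}` IS an L-packet of `U(Φ₂)(L⁺_v)` — the body of S4-B's `IsRogPacketU2 L v {⟦ℂ_ψ⟧}` with witness `⟦ℂ_ψ⟧` (conjunct 1 =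
  brick (b4) «`⟦ℂ_ψ⟧` admissible»; brick (b3) is ★ `R90.S3.comap_cmDatumLocalCongr_mk_ofChar` itself).
* §3 **(LK-1D) assembled**: `exists_packetU2_singleton_eq_map_boxChar_of_finrank_eq_one` (existence: `{⟦r⟧} = {⟦ℂ_ψ⟧}.map (boxChar χ)`), `eq_singleton_of_mem_of_finrank_eq_one`
  (uniqueness, ★ T1 + §1), and their conjunction `packetH_singleton_and_eq_singleton_of_finrank_eq_one` = the socket statement with S4-B's predicates unfolded.
HONEST LABEL: HC_CM is proved only modulo the 7 printed citations (2 remaining named inputs: hLiu418 = `stmt-HodgeConjecture-24832`, h413 = `stmt-HodgeConjecture-24833`) until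
rung 0 closes; REL ≠ ★ ≠ BUILT; this file is sorry-free local representation theory and pays no socket by itself ((LK-1D) is paid Lines-side at A ED. 4 by the fold above); count-neutral.

## References
* [Rogawski1990] J. D. Rogawski, *Automorphic Representations of Unitary Groups in Three Variables*, Ann. of Math. Stud. 123 (1990), §11.1 p. 161 (L-packets on `U(2)` =
  `PGL₂(F)`-orbits), §12.1 pp. 171–172 («`ρ = ρ₁ ⊗ χ`»; the L-packets of cardinality one, type (3)), §13.1 Prop. 13.1.4 p. 199.
* [Dieudonne1971GroupesClassiques] J. Dieudonné, *La géométrie des groupes classiques*, 3e éd. (1971), Chap. II §5 (`SU ≤ U′`).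
* [BushnellHenniart2006] C. J. Bushnell, G. Henniart, *The Local Langlands Conjecture for GL(2)* (2006), §1.1, §1.5 (characters as one-dimensional smooth representations), §9.1.
* [PlatonovRapinchuk1994] V. Platonov, A. Rapinchuk, *Algebraic Groups and Number Theory* (1994), §2.3 (similitudes).
-/

set_option autoImplicit false
-- the mandated namespace repeats the single-problem summit's segment (`HodgeConjecture.HodgeConjecture`)
set_option linter.dupNamespace false

noncomputable section

open NumberField IsDedekindDomain
open scoped MatrixGroups
open Literature.NumberTheory.Automorphic Literature.NumberTheory.Automorphic.UnitaryGroup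

namespace Summit.HodgeConjecture.HodgeConjecture.R90.S4

/-! ## §1 A one-dimensional smooth irreducible representation is the class of a character with open kernel -/

section OneDim

universe u

variable {G : Type u} [Group G] [TopologicalSpace G] [IsTopologicalGroup G]

/-- **A ONE-DIMENSIONAL SMOOTH IRREDUCIBLE `r` IS `⟦ℂ_Ξ⟧` FOR A CHARACTER `Ξ` WITH OPEN KERNEL**: `Ξ(g)` is the scalar by which `r(g)` acts on the line `r.V = ℂ·v`
(multiplicative since `v ≠ 0`), `ker Ξ` is the stabiliser of `v` (open: `r` is smooth), and `z ↦ z • v` intertwines `ℂ_Ξ = (trivial ℂ G ℂ) ⊗ Ξ` (★ `SmoothIrrep.ofChar`) with `r`.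
[cite: BushnellHenniart2006, §1.1; §1.5] [cite: Rogawski1990, §12.1 p. 171] -/
theorem exists_mk_eq_mk_ofChar_of_finrank_eq_one (r : SmoothIrrep G) (h1 : Module.finrank ℂ r.V = 1) :
    ∃ (Ξ : G →* ℂˣ) (hΞ : IsOpen ((Ξ.ker : Subgroup G) : Set G)), IrrClass.mk r = IrrClass.mk (SmoothIrrep.ofChar Ξ hΞ) := by
  obtain ⟨v, hv0, hv⟩ := finrank_eq_one_iff'.1 h1
  choose c hc using fun g => hv (r.ρ g v)
  -- `hc g : c g • v = r.ρ g v`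
  have hinj : Function.Injective fun a : ℂ => a • v := smul_left_injective ℂ hv0
  have hc1 : c 1 = 1 := by
    apply hinj
    simp only
    rw [hc 1, map_one, Module.End.one_apply, one_smul]
  have hmul : ∀ g h : G, c (g * h) = c g * c h := by
    intro g h
    apply hinj
    simp only
    rw [hc, map_mul, Module.End.mul_apply, ← hc h, map_smul, ← hc g, smul_smul, mul_comm]
  let φ : G →* ℂ := { toFun := c, map_one' := hc1, map_mul' := hmul }
  let Ξ : G →* ℂˣ := φ.toHomUnits
  have hΞc : ∀ g, ((Ξ g : ℂˣ) : ℂ) = c g := fun _ => rfl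
  -- `ker Ξ` is the stabiliser of `v`
  have hker : ((Ξ.ker : Subgroup G) : Set G) = (r.ρ.stabilizerSubgroup v : Set G) := by
    ext g
    simp only [SetLike.mem_coe, MonoidHom.mem_ker, Representation.mem_stabilizerSubgroup]
    constructor
    · intro h
      have hcg : c g = 1 := by rw [← hΞc, h, Units.val_one]
      rw [← hc g, hcg, one_smul]
    · intro h
      have hcg : c g = 1 := by
        apply hinj
        simp only
        rw [hc g, h, one_smul]
      exact Units.ext (by rw [hΞc, hcg, Units.val_one])
  have hΞ : IsOpen ((Ξ.ker : Subgroup G) : Set G) := by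
    rw [hker]
    exact r.isSmooth v
  refine ⟨Ξ, hΞ, ?_⟩
  -- the equivalence `ℂ_Ξ ≃ r`, `z ↦ z • v`
  have hsurj : Function.Surjective (LinearMap.toSpanSingleton ℂ r.V v) := fun w => by
    obtain ⟨a, ha⟩ := hv w
    exact ⟨a, by rw [LinearMap.toSpanSingleton_apply, ha]⟩
  have hinj' : Function.Injective (LinearMap.toSpanSingleton ℂ r.V v) := fun a b hab => by
    apply hinj
    simpa only [LinearMap.toSpanSingleton_apply] using hab
  let e : ℂ ≃ₗ[ℂ] r.V := LinearEquiv.ofBijective (LinearMap.toSpanSingleton ℂ r.V v) ⟨hinj', hsurj⟩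
  have he : ∀ z : ℂ, e z = z • v := fun z => rfl
  symm
  refine IrrClass.mk_eq_mk_of_equiv (Representation.Equiv.mk (ρ := (SmoothIrrep.ofChar Ξ hΞ).ρ) (σ := r.ρ) e fun g => ?_)
  refine LinearMap.ext fun z => ?_
  show e ((SmoothIrrep.ofChar Ξ hΞ).ρ g z) = r.ρ g (e z)
  rw [SmoothIrrep.ofChar_ρ_apply, hΞc, he, he, map_smul, ← hc g, smul_smul, mul_comm]

/-- **At a product `G × G₁`: a one-dimensional smooth irreducible `r` is `boxChar χ ⟦ℂ_ψ⟧`** for smooth characters `ψ` of `G` and `χ` of `G₁` (§1 + ★ (L4)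
`IrrClass.mk_ofChar_eq_boxChar`: `ψ = Ξ ∘ inl`, `χ = Ξ ∘ inr`).  For `H_v = U(Φ₂)_v × U(Φ₁)_v` this is the shape `S = O.map (boxChar χ)` of S4-B's `IsRogPacketH` with `O = {⟦ℂ_ψ⟧}`.
[cite: Rogawski1990, §12.1 pp. 171–172] [cite: BushnellHenniart2006, §9.1] -/
theorem exists_mk_eq_boxChar_mk_ofChar_of_finrank_eq_one {G₁ : Type u} [Group G₁] [TopologicalSpace G₁] [IsTopologicalGroup G₁]
    (r : SmoothIrrep (G × G₁)) (h1 : Module.finrank ℂ r.V = 1) :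
    ∃ (ψ : G →* ℂˣ) (hψ : IsOpen ((ψ.ker : Subgroup G) : Set G)) (χ : G₁ →* ℂˣ) (hχ : IsOpen ((χ.ker : Subgroup G₁) : Set G₁)),
      IrrClass.mk r = IrrClass.boxChar χ hχ (IrrClass.mk (SmoothIrrep.ofChar ψ hψ)) := by
  obtain ⟨Ξ, hΞ, hr⟩ := exists_mk_eq_mk_ofChar_of_finrank_eq_one r h1
  exact ⟨Ξ.comp (MonoidHom.inl G G₁), IrrClass.isOpen_ker_comp_inl hΞ, Ξ.comp (MonoidHom.inr G G₁), IrrClass.isOpen_ker_comp_inr hΞ,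
    hr.trans (IrrClass.mk_ofChar_eq_boxChar Ξ hΞ)⟩

end OneDim

/-! ## §2 `{⟦ℂ_ψ⟧}` is an L-packet of `U(Φ₂)(L⁺_v)`: the body of S4-B's `IsRogPacketU2 L v {⟦ℂ_ψ⟧}` with witness `σ := ⟦ℂ_ψ⟧` -/

section CM

variable (L : Type) [Field L] [NumberField L] [IsCMField L] (v : HeightOneSpectrum (𝓞 ↥(maximalRealSubfield L)))

/-- **`{⟦ℂ_ψ⟧}` IS AN L-PACKET OF `U(Φ₂)(L⁺_v)`** — the body of S4-B's `IsRogPacketU2 L v {⟦ℂ_ψ⟧}` (`Cruxes/H413/Lines/R90_S4_HPacketsU2B.lean` :208, with `IsU2SimilConj` :200–:204 and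
`Φ₂Loc` UNFOLDED byte for byte, witness `σ := ⟦ℂ_ψ⟧`): `⟦ℂ_ψ⟧` is admissible (★ `isAdmissible_trivial_twist` read on the class by ★ `IrrClass.isAdmissible_mk`) and the members of
`{⟦ℂ_ψ⟧}` are EXACTLY the similitude conjugates `⟦ℂ_ψ⟧ ∘ Ad(T)` (`ᵗT̄ Φ₂ T = a Φ₂`) of `⟦ℂ_ψ⟧` — «⊆» by ★ `R90.S4.u2SimilConj_refl` (`T = 1`), «⊇» by ★ `R90.S3.eq_of_u2SimilConj_mk_ofChar`
(a character of `U(Φ₂)(L⁺_v)` is fixed by every `Ad(T)`: `det (T g T⁻¹ g⁻¹) = 1` and every homomorphism to an abelian group kills `SU`, Dieudonné).  Print: «by definition, an L-packet on `U(2)` is a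
`PGL₂(F)`-orbit» (§11.1) and «the L-packets of cardinality one on `H` are … (3) the one-dimensional representations» (§12.1).  Conjunct 1 is brick (b4) of R90-C131-typ1 (g2)'s assembly.
[cite: Rogawski1990, §11.1 p. 161; §12.1 p. 171 (3)] [cite: Dieudonne1971GroupesClassiques, Chap. II §5] [cite: BushnellHenniart2006, §1.5] -/
theorem isAdmissible_and_mem_singleton_iff_u2SimilConj
    (ψ : (cmDatum L 2 (Matrix.of fun i j : Fin 2 => if i.val + j.val + 1 = 2 then (1 : L) else 0)).Local v →* ℂˣ)
    (hψ : IsOpen ((ψ.ker : Subgroup ((cmDatum L 2 (Matrix.of fun i j : Fin 2 => if i.val + j.val + 1 = 2 then (1 : L) else 0)).Local v)) :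
      Set ((cmDatum L 2 (Matrix.of fun i j : Fin 2 => if i.val + j.val + 1 = 2 then (1 : L) else 0)).Local v))) :
    (IrrClass.mk (SmoothIrrep.ofChar ψ hψ)).IsAdmissible ∧
      ∀ c, c ∈ ({IrrClass.mk (SmoothIrrep.ofChar ψ hψ)} :
          Finset (IrrClass ((cmDatum L 2 (Matrix.of fun i j : Fin 2 => if i.val + j.val + 1 = 2 then (1 : L) else 0)).Local v))) ↔
        ∃ (T : GL (Fin 2) (LocalRing L v)) (a : LocalRing L v) (ha : IsUnit a)
          (h : formCongr (conjLocal L (IsCMField.complexConj L) v) T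
              ((Matrix.of fun i j : Fin 2 => if i.val + j.val + 1 = 2 then (1 : L) else 0).map (algebraMap L (LocalRing L v))) =
            a • (Matrix.of fun i j : Fin 2 => if i.val + j.val + 1 = 2 then (1 : L) else 0).map (algebraMap L (LocalRing L v))),
          c = IrrClass.comap (cmDatumLocalCongr L v T ha h) (IrrClass.mk (SmoothIrrep.ofChar ψ hψ)) := by
  refine ⟨(IrrClass.isAdmissible_mk _).2 (isAdmissible_trivial_twist hψ), fun c => ?_⟩
  rw [Finset.mem_singleton]
  constructor
  · rintro rfl
    exact u2SimilConj_refl L v _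
  · exact fun hc => Summit.HodgeConjecture.HodgeConjecture.R90.S3.eq_of_u2SimilConj_mk_ofChar L v ψ hψ hc

/-! ## §3 (LK-1D) for `H_v = U(Φ₂)_v × U(Φ₁)_v`: `{⟦r⟧}` is an L-packet and the only L-packet through `⟦r⟧`, for every one-dimensional smooth irreducible `r` -/

/-- **(LK-1D, existence) `{⟦r⟧}` IS AN L-PACKET OF `H_v`** for `r` one-dimensional — the body of S4-B's `IsRogPacketH L v {IrrClass.mk r}` (:213; `IsRogPacketU2`, `IsU2SimilConj`,
`Φ₂Loc`, `U2Loc`, `U1Loc`, `HLoc` UNFOLDED byte for byte, as ★ `R90.S3.eq_singleton_of_mem_of_isOneDimH` spells them): `⟦r⟧ = boxChar χ ⟦ℂ_ψ⟧` (§1 + ★ (L4)), `O := {⟦ℂ_ψ⟧}` is an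
L-packet of `U(Φ₂)_v` (§2), and `{⟦r⟧} = O.map (boxChar χ)` (`Finset.map_singleton`).  «`ρ = ρ₁ ⊗ χ`», type (3). [cite: Rogawski1990, §11.1 p. 161; §12.1 pp. 171–172 (3)] -/
theorem exists_packetU2_singleton_eq_map_boxChar_of_finrank_eq_one
    (r : SmoothIrrep ((cmDatum L 2 (Matrix.of fun i j : Fin 2 => if i.val + j.val + 1 = 2 then (1 : L) else 0)).Local v ×
      (cmDatum L 1 (Matrix.of fun i j : Fin 1 => if i.val + j.val + 1 = 1 then (1 : L) else 0)).Local v))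
    (h1 : Module.finrank ℂ r.V = 1) :
    ∃ (O : Finset (IrrClass ((cmDatum L 2 (Matrix.of fun i j : Fin 2 => if i.val + j.val + 1 = 2 then (1 : L) else 0)).Local v)))
      (χ : (cmDatum L 1 (Matrix.of fun i j : Fin 1 => if i.val + j.val + 1 = 1 then (1 : L) else 0)).Local v →* ℂˣ)
      (hχ : IsOpen ((χ.ker : Subgroup ((cmDatum L 1 (Matrix.of fun i j : Fin 1 => if i.val + j.val + 1 = 1 then (1 : L) else 0)).Local v)) :
        Set ((cmDatum L 1 (Matrix.of fun i j : Fin 1 => if i.val + j.val + 1 = 1 then (1 : L) else 0)).Local v))),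
      (∃ σ : IrrClass ((cmDatum L 2 (Matrix.of fun i j : Fin 2 => if i.val + j.val + 1 = 2 then (1 : L) else 0)).Local v),
        σ.IsAdmissible ∧ ∀ c, c ∈ O ↔
          ∃ (T : GL (Fin 2) (LocalRing L v)) (a : LocalRing L v) (ha : IsUnit a)
            (h : formCongr (conjLocal L (IsCMField.complexConj L) v) T
                ((Matrix.of fun i j : Fin 2 => if i.val + j.val + 1 = 2 then (1 : L) else 0).map (algebraMap L (LocalRing L v))) =
              a • (Matrix.of fun i j : Fin 2 => if i.val + j.val + 1 = 2 then (1 : L) else 0).map (algebraMap L (LocalRing L v))),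
            c = IrrClass.comap (cmDatumLocalCongr L v T ha h) σ) ∧
      ({IrrClass.mk r} :
          Finset (IrrClass ((cmDatum L 2 (Matrix.of fun i j : Fin 2 => if i.val + j.val + 1 = 2 then (1 : L) else 0)).Local v ×
            (cmDatum L 1 (Matrix.of fun i j : Fin 1 => if i.val + j.val + 1 = 1 then (1 : L) else 0)).Local v))) =
        O.map ⟨IrrClass.boxChar χ hχ, IrrClass.boxChar_injective χ hχ⟩ := by
  obtain ⟨ψ, hψ, χ, hχ, hr⟩ := exists_mk_eq_boxChar_mk_ofChar_of_finrank_eq_one r h1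
  refine ⟨{IrrClass.mk (SmoothIrrep.ofChar ψ hψ)}, χ, hχ,
    ⟨IrrClass.mk (SmoothIrrep.ofChar ψ hψ), isAdmissible_and_mem_singleton_iff_u2SimilConj L v ψ hψ⟩, ?_⟩
  rw [Finset.map_singleton, hr]
  rfl

/-- **(LK-1D, uniqueness) AN L-PACKET OF `H_v` THROUGH A ONE-DIMENSIONAL `⟦r⟧` IS `{⟦r⟧}`** (S4-B's `IsRogPacketH L v S` UNFOLDED byte for byte): §1 makes `⟦r⟧` one-dimensional in S4-B's
sense `IsOneDimH` (`⟦r⟧ = ⟦ℂ_Ξ⟧`), and ★ `R90.S3.eq_singleton_of_mem_of_isOneDimH` (T1, sharp form: ★ joint rigidity `eq_of_boxChar_eq_mk_ofChar` + the trivial similitude orbit of a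
character class) concludes. [cite: Rogawski1990, §11.1 p. 161; §12.1 pp. 171–172 (3); §13.1 Prop. 13.1.4 p. 199] -/
theorem eq_singleton_of_mem_of_finrank_eq_one
    (S : Finset (IrrClass ((cmDatum L 2 (Matrix.of fun i j : Fin 2 => if i.val + j.val + 1 = 2 then (1 : L) else 0)).Local v ×
      (cmDatum L 1 (Matrix.of fun i j : Fin 1 => if i.val + j.val + 1 = 1 then (1 : L) else 0)).Local v)))
    (hS : ∃ (O : Finset (IrrClass ((cmDatum L 2 (Matrix.of fun i j : Fin 2 => if i.val + j.val + 1 = 2 then (1 : L) else 0)).Local v)))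
        (χ : (cmDatum L 1 (Matrix.of fun i j : Fin 1 => if i.val + j.val + 1 = 1 then (1 : L) else 0)).Local v →* ℂˣ)
        (hχ : IsOpen ((χ.ker : Subgroup ((cmDatum L 1 (Matrix.of fun i j : Fin 1 => if i.val + j.val + 1 = 1 then (1 : L) else 0)).Local v)) :
          Set ((cmDatum L 1 (Matrix.of fun i j : Fin 1 => if i.val + j.val + 1 = 1 then (1 : L) else 0)).Local v))),
        (∃ σ : IrrClass ((cmDatum L 2 (Matrix.of fun i j : Fin 2 => if i.val + j.val + 1 = 2 then (1 : L) else 0)).Local v),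
          σ.IsAdmissible ∧ ∀ c, c ∈ O ↔
            ∃ (T : GL (Fin 2) (LocalRing L v)) (a : LocalRing L v) (ha : IsUnit a)
              (h : formCongr (conjLocal L (IsCMField.complexConj L) v) T
                  ((Matrix.of fun i j : Fin 2 => if i.val + j.val + 1 = 2 then (1 : L) else 0).map (algebraMap L (LocalRing L v))) =
                a • (Matrix.of fun i j : Fin 2 => if i.val + j.val + 1 = 2 then (1 : L) else 0).map (algebraMap L (LocalRing L v))),
              c = IrrClass.comap (cmDatumLocalCongr L v T ha h) σ) ∧
        S = O.map ⟨IrrClass.boxChar χ hχ, IrrClass.boxChar_injective χ hχ⟩)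
    (r : SmoothIrrep ((cmDatum L 2 (Matrix.of fun i j : Fin 2 => if i.val + j.val + 1 = 2 then (1 : L) else 0)).Local v ×
      (cmDatum L 1 (Matrix.of fun i j : Fin 1 => if i.val + j.val + 1 = 1 then (1 : L) else 0)).Local v))
    (h1 : Module.finrank ℂ r.V = 1) (hr : IrrClass.mk r ∈ S) : S = {IrrClass.mk r} :=
  Summit.HodgeConjecture.HodgeConjecture.R90.S3.eq_singleton_of_mem_of_isOneDimH L v S hS hr
    (exists_mk_eq_mk_ofChar_of_finrank_eq_one r h1)

/-- **(LK-1D) «ONE-DIMENSIONAL REPRESENTATIONS OF `H_v` ARE L-PACKETS OF CARDINALITY ONE»** — the statement of S4-A's socket `stub_R90_S4_lk_oneDimPkt (r : SmoothIrrep (HLoc L v))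
(h1 : Module.finrank ℂ r.V = 1) : IsRogPacketH L v {IrrClass.mk r} ∧ ∀ S, IsRogPacketH L v S → IrrClass.mk r ∈ S → S = {IrrClass.mk r}` with S4-B's `IsRogPacketH` ∕ `IsRogPacketU2` ∕
`IsU2SimilConj` ∕ `Φ₂Loc` ∕ `HLoc` UNFOLDED byte for byte (so the socket is paid Lines-side by `:= R90.S4.packetH_singleton_and_eq_singleton_of_finrank_eq_one L v r h1`, a definitional fold):
existence §3a, uniqueness §3b.  Rogawski §12.1 p. 171: «The L-packets of cardinality one on `H` are (1) … (2) … (3) the one-dimensional representations.»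
[cite: Rogawski1990, §11.1 p. 161; §12.1 pp. 171–172 (3)] -/
theorem packetH_singleton_and_eq_singleton_of_finrank_eq_one
    (r : SmoothIrrep ((cmDatum L 2 (Matrix.of fun i j : Fin 2 => if i.val + j.val + 1 = 2 then (1 : L) else 0)).Local v ×
      (cmDatum L 1 (Matrix.of fun i j : Fin 1 => if i.val + j.val + 1 = 1 then (1 : L) else 0)).Local v))
    (h1 : Module.finrank ℂ r.V = 1) :
    (∃ (O : Finset (IrrClass ((cmDatum L 2 (Matrix.of fun i j : Fin 2 => if i.val + j.val + 1 = 2 then (1 : L) else 0)).Local v)))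
        (χ : (cmDatum L 1 (Matrix.of fun i j : Fin 1 => if i.val + j.val + 1 = 1 then (1 : L) else 0)).Local v →* ℂˣ)
        (hχ : IsOpen ((χ.ker : Subgroup ((cmDatum L 1 (Matrix.of fun i j : Fin 1 => if i.val + j.val + 1 = 1 then (1 : L) else 0)).Local v)) :
          Set ((cmDatum L 1 (Matrix.of fun i j : Fin 1 => if i.val + j.val + 1 = 1 then (1 : L) else 0)).Local v))),
        (∃ σ : IrrClass ((cmDatum L 2 (Matrix.of fun i j : Fin 2 => if i.val + j.val + 1 = 2 then (1 : L) else 0)).Local v),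
          σ.IsAdmissible ∧ ∀ c, c ∈ O ↔
            ∃ (T : GL (Fin 2) (LocalRing L v)) (a : LocalRing L v) (ha : IsUnit a)
              (h : formCongr (conjLocal L (IsCMField.complexConj L) v) T
                  ((Matrix.of fun i j : Fin 2 => if i.val + j.val + 1 = 2 then (1 : L) else 0).map (algebraMap L (LocalRing L v))) =
                a • (Matrix.of fun i j : Fin 2 => if i.val + j.val + 1 = 2 then (1 : L) else 0).map (algebraMap L (LocalRing L v))),
              c = IrrClass.comap (cmDatumLocalCongr L v T ha h) σ) ∧
        ({IrrClass.mk r} :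
            Finset (IrrClass ((cmDatum L 2 (Matrix.of fun i j : Fin 2 => if i.val + j.val + 1 = 2 then (1 : L) else 0)).Local v ×
              (cmDatum L 1 (Matrix.of fun i j : Fin 1 => if i.val + j.val + 1 = 1 then (1 : L) else 0)).Local v))) =
          O.map ⟨IrrClass.boxChar χ hχ, IrrClass.boxChar_injective χ hχ⟩) ∧
      ∀ S : Finset (IrrClass ((cmDatum L 2 (Matrix.of fun i j : Fin 2 => if i.val + j.val + 1 = 2 then (1 : L) else 0)).Local v ×
          (cmDatum L 1 (Matrix.of fun i j : Fin 1 => if i.val + j.val + 1 = 1 then (1 : L) else 0)).Local v)),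
        (∃ (O : Finset (IrrClass ((cmDatum L 2 (Matrix.of fun i j : Fin 2 => if i.val + j.val + 1 = 2 then (1 : L) else 0)).Local v)))
            (χ : (cmDatum L 1 (Matrix.of fun i j : Fin 1 => if i.val + j.val + 1 = 1 then (1 : L) else 0)).Local v →* ℂˣ)
            (hχ : IsOpen ((χ.ker : Subgroup ((cmDatum L 1 (Matrix.of fun i j : Fin 1 => if i.val + j.val + 1 = 1 then (1 : L) else 0)).Local v)) :
              Set ((cmDatum L 1 (Matrix.of fun i j : Fin 1 => if i.val + j.val + 1 = 1 then (1 : L) else 0)).Local v))),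
            (∃ σ : IrrClass ((cmDatum L 2 (Matrix.of fun i j : Fin 2 => if i.val + j.val + 1 = 2 then (1 : L) else 0)).Local v),
              σ.IsAdmissible ∧ ∀ c, c ∈ O ↔
                ∃ (T : GL (Fin 2) (LocalRing L v)) (a : LocalRing L v) (ha : IsUnit a)
                  (h : formCongr (conjLocal L (IsCMField.complexConj L) v) T
                      ((Matrix.of fun i j : Fin 2 => if i.val + j.val + 1 = 2 then (1 : L) else 0).map (algebraMap L (LocalRing L v))) =
                    a • (Matrix.of fun i j : Fin 2 => if i.val + j.val + 1 = 2 then (1 : L) else 0).map (algebraMap L (LocalRing L v))),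
                  c = IrrClass.comap (cmDatumLocalCongr L v T ha h) σ) ∧
            S = O.map ⟨IrrClass.boxChar χ hχ, IrrClass.boxChar_injective χ hχ⟩) →
        IrrClass.mk r ∈ S → S = {IrrClass.mk r} :=
  ⟨exists_packetU2_singleton_eq_map_boxChar_of_finrank_eq_one L v r h1,
    fun S hS hr => eq_singleton_of_mem_of_finrank_eq_one L v S hS r h1 hr⟩

end CM

end Summit.HodgeConjecture.HodgeConjecture.R90.S4

end
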